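import Summits.NavierStokesRegularity.OSWSelfSimilar.SheetRGudermannianSeries
import Mathlib.Analysis.PSeries
import HarnessLib

/-!
# SHEET-ℝ frame: the sine series of the far-field shape itself, `sin(θ/2)cos²(θ/2) = Σ_{k≥1} t_k sin kθ`

HONEST FRAMING (cell ns-blowup GROUP B / zone Z3, case Z3-SR-CERT; 1-D MODEL certificate frame; not Euler/NS).

PRICE-impl1 §4 T1 lists «T₂ = Σ t_k sin kθ, t ~ k⁻³» as the first of the three explicit series of the interval stage
(`T₂^{PRICE} = L²·T₂ = sin(θ/2)cos²(θ/2)` at `ξ = L tan(θ/2)`, `SheetRFarFieldT2.farFieldT2_cayley`). This file PROVES, for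
`θ ∈ (−π, π)` and with the index `n = k − 1`,

  `sin(θ/2)·cos²(θ/2) = Σ_{n≥0} t_{n+1} sin((n+1)θ)`,  `t_k = (−1)^k·16k/(π(4k²−1)(4k²−9))
        = ((−1)^k/(2π))·[1/(2k−3) − 1/(2k−1) − 1/(2k+1) + 1/(2k+3)]`  (`t_1 = 16/(15π)`, `|t_k| ≤ 2/k²`),

together with the cosine companion `Σ t_k cos kθ = (2π)⁻¹[2cos θ + 2/3 − gd⁻¹(θ/2)·(sin(3θ/2) + sin(θ/2))]` and the tail bound.
PROOF = the complex-boundary method of `SheetRGudermannianSeries`: on the open disc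
`2π·Σ_k t_k w^{2k} = arctan(w)·(w³ + w − w⁻¹ − w⁻³) + w² + 1 + w⁻² − 1/3` (four shifted arctangent series), continuity on the closed
disc (M-test with `2/k²`), radial approach to `w₀ = e^{iθ/2}`, and `arctan(e^{iφ}) = π/4 + (i/2)·arsinh(tan φ)`; on the circle
`w³ + w − w⁻¹ − w⁻³ = 2i(sin 3φ + sin φ)` is purely imaginary, so the logarithm drops out of the imaginary part:
`Σ t_k sin kθ = ¼(sin(3θ/2) + sin(θ/2)) = sin(θ/2)cos²(θ/2)`. Pure analysis about explicit functions; no definition, no named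
fact, nothing asserted about any profile. MODEL frame bookkeeping only.
-/

noncomputable section

namespace Summit.NavierStokesRegularity.OSWSelfSimilar
namespace SheetRFarFieldT2SineSeries

open _root_.Complex _root_.Filter _root_.Metric _root_.Set _root_.Finset
open scoped Real Topology
open SheetRGudermannianSeries

/-! ### §0 The trigonometric identity and the coefficients -/

/-- `sin(θ/2)·cos²(θ/2) = ¼(sin(3θ/2) + sin(θ/2))`. [folklore] -/
theorem sin_half_mul_cos_half_sq (θ : ℝ) :
    Real.sin (θ / 2) * Real.cos (θ / 2) ^ 2 = (Real.sin (3 * (θ / 2)) + Real.sin (θ / 2)) / 4 := by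
  rw [Real.sin_three_mul, Real.cos_sq']
  ring

/-- Partial fractions of the (`2π`-scaled) coefficient: `32(n+1)/((4(n+1)²−1)(4(n+1)²−9)) = 1/(2n−1) − 1/(2n+1) − 1/(2n+3) + 1/(2n+5)`
(over `ℂ`; all four denominators are non-zero for `n ∈ ℕ`). [folklore] -/
theorem coeff_partial_fractions (n : ℕ) :
    (32 * ((n : ℂ) + 1) / ((4 * ((n : ℂ) + 1) ^ 2 - 1) * (4 * ((n : ℂ) + 1) ^ 2 - 9))) =
      1 / (2 * (n : ℂ) - 1) - 1 / (2 * (n : ℂ) + 1) - 1 / (2 * (n : ℂ) + 3) + 1 / (2 * (n : ℂ) + 5) := by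
  have h1 : (2 * (n : ℂ) - 1) ≠ 0 := by exact_mod_cast (show (2 * (n : ℤ) - 1 : ℤ) ≠ 0 by omega)
  have h2 : (2 * (n : ℂ) + 1) ≠ 0 := by norm_cast
  have h3 : (2 * (n : ℂ) + 3) ≠ 0 := by norm_cast
  have h4 : (2 * (n : ℂ) + 5) ≠ 0 := by norm_cast
  have hA : (4 * ((n : ℂ) + 1) ^ 2 - 1) = (2 * (n : ℂ) + 1) * (2 * (n : ℂ) + 3) := by ring
  have hB : (4 * ((n : ℂ) + 1) ^ 2 - 9) = (2 * (n : ℂ) - 1) * (2 * (n : ℂ) + 5) := by ring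
  rw [hA, hB, div_sub_div _ _ h1 h2, div_sub_div _ _ (mul_ne_zero h1 h2) h3,
    div_add_div _ _ (mul_ne_zero (mul_ne_zero h1 h2) h3) h4,
    div_eq_div_iff (mul_ne_zero (mul_ne_zero h2 h3) (mul_ne_zero h1 h4))
      (mul_ne_zero (mul_ne_zero (mul_ne_zero h1 h2) h3) h4)]
  ring

/-- Size of the (`2π`-scaled) coefficients: `32(n+1)/((4(n+1)²−1)|4(n+1)²−9|) ≤ 6/(n+1)²` (`t_k = O(k⁻³)`, summably dominated).
[folklore] -/
theorem abs_coeff_le (n : ℕ) :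
    |(-1 : ℝ) ^ (n + 1) * (32 * ((n : ℝ) + 1)) / ((4 * ((n : ℝ) + 1) ^ 2 - 1) * (4 * ((n : ℝ) + 1) ^ 2 - 9))| ≤
      6 / ((n : ℝ) + 1) ^ 2 := by
  have hn : (0 : ℝ) ≤ n := n.cast_nonneg
  have hA : (0:ℝ) < 4 * ((n:ℝ) + 1) ^ 2 - 1 := by nlinarith
  rw [abs_div, abs_mul, abs_pow, abs_neg, abs_one, one_pow, one_mul, abs_of_pos (by positivity : (0:ℝ) < 32 * ((n:ℝ) + 1)),
    abs_mul, abs_of_pos hA]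
  rcases Nat.eq_zero_or_pos n with h0 | hpos
  · subst h0
    norm_num
  · have hn1 : (1 : ℝ) ≤ n := by exact_mod_cast hpos
    set k : ℝ := (n : ℝ) + 1 with hk_def
    have hk : (2:ℝ) ≤ k := by rw [hk_def]; linarith
    have hB : (0:ℝ) < 4 * k ^ 2 - 9 := by nlinarith
    rw [abs_of_pos hB, div_le_div_iff₀ (mul_pos hA hB) (by positivity)]
    -- `32k·k² ≤ 6·(4k²−1)(4k²−9)` for `k ≥ 2`
    have h2 : 2 * k ≤ k ^ 2 := by nlinarith
    have h3 : 2 * k ^ 2 ≤ k ^ 3 := by nlinarith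
    have h4 : 4 * k ^ 2 ≤ k ^ 4 := by nlinarith
    nlinarith

/-- The absolute coefficients are summable. [folklore] -/
theorem summable_abs_coeff_T2 :
    Summable (fun n : ℕ =>
      |(-1 : ℝ) ^ (n + 1) * (32 * ((n : ℝ) + 1)) / ((4 * ((n : ℝ) + 1) ^ 2 - 1) * (4 * ((n : ℝ) + 1) ^ 2 - 9))|) := by
  have hs : Summable (fun n : ℕ => 6 / ((n : ℝ) + 1) ^ 2) := by
    have h := (summable_nat_add_iff 1).mpr (Real.summable_one_div_nat_pow.mpr (one_lt_two : 1 < 2))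
    refine (h.mul_left 6).congr fun n => ?_
    push_cast
    ring
  exact hs.of_nonneg_of_le (fun n => abs_nonneg _) abs_coeff_le

/-! ### §1 The generating identity on the open unit disc -/

/-- On `0 < ‖w‖ < 1`: `Σ_{n≥0} (−1)^{n+1}·32(n+1)/((4(n+1)²−1)(4(n+1)²−9))·w^{2n+2}
= arctan(w)·(w³ + w − w⁻¹ − w⁻³) + w² + 1 + w⁻² − 1/3` (four shifted arctangent series). [folklore] -/
theorem hasSum_coeff_mul_pow_of_norm_lt_one {w : ℂ} (hw : ‖w‖ < 1) (hw0 : w ≠ 0) :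
    HasSum (fun n : ℕ => ((((-1 : ℝ) ^ (n + 1) * (32 * ((n : ℝ) + 1)) /
        ((4 * ((n : ℝ) + 1) ^ 2 - 1) * (4 * ((n : ℝ) + 1) ^ 2 - 9))) : ℝ) : ℂ) * w ^ (2 * n + 2))
      (Complex.arctan w * (w ^ 3 + w - w⁻¹ - (w ^ 3)⁻¹) + w ^ 2 + 1 + (w ^ 2)⁻¹ - 1 / 3) := by
  have h := Complex.hasSum_arctan hw
  have hcast : ∀ n : ℕ, ((2 * n + 1 : ℕ) : ℂ) = 2 * (n : ℂ) + 1 := fun n => by push_cast; ring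
  -- S2: denominators `2n+1`
  have hS2 : HasSum (fun n : ℕ => (-1 : ℂ) ^ (n + 1) * w ^ (2 * n + 2) / (2 * (n : ℂ) + 1)) (-w * Complex.arctan w) := by
    refine (h.mul_left (-w)).congr_fun fun n => ?_
    rw [hcast]; ring
  -- S3: denominators `2n+3` (shift by one)
  have hS3 : HasSum (fun n : ℕ => (-1 : ℂ) ^ (n + 1) * w ^ (2 * n + 2) / (2 * (n : ℂ) + 3))
      (w⁻¹ * Complex.arctan w - 1) := by
    have h2 := (hasSum_nat_add_iff' 1).mpr (h.mul_left w⁻¹)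
    simp only [sum_range_one, pow_zero, one_mul, mul_zero, zero_add, pow_one, Nat.cast_one, div_one,
      inv_mul_cancel₀ hw0] at h2
    refine h2.congr_fun fun n => ?_
    have hc : ((2 * (n + 1) + 1 : ℕ) : ℂ) = 2 * (n : ℂ) + 3 := by push_cast; ring
    rw [hc]
    field_simp
    ring
  -- S4: denominators `2n+5` (shift by two)
  have hS4 : HasSum (fun n : ℕ => (-1 : ℂ) ^ (n + 1) * w ^ (2 * n + 2) / (2 * (n : ℂ) + 5))
      (-(w ^ 3)⁻¹ * Complex.arctan w + (w ^ 2)⁻¹ - 1 / 3) := by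
    have h2 := (hasSum_nat_add_iff' 2).mpr (h.mul_left (-(w ^ 3)⁻¹))
    have hval : -(w ^ 3)⁻¹ * Complex.arctan w -
        ∑ i ∈ range 2, -(w ^ 3)⁻¹ * ((-1) ^ i * w ^ (2 * i + 1) / ((2 * i + 1 : ℕ) : ℂ)) =
        -(w ^ 3)⁻¹ * Complex.arctan w + (w ^ 2)⁻¹ - 1 / 3 := by
      simp only [sum_range_succ, sum_range_zero, pow_zero, one_mul, mul_zero, zero_add, pow_one, Nat.cast_one,
        div_one, mul_one]
      push_cast
      field_simp
      ring
    rw [hval] at h2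
    refine h2.congr_fun fun n => ?_
    have hc : ((2 * (n + 2) + 1 : ℕ) : ℂ) = 2 * (n : ℂ) + 5 := by push_cast; ring
    rw [hc]
    field_simp
    ring
  -- S1: denominators `2n−1` (un-shift by one: the `n = 0` term is `w²`)
  have hS1 : HasSum (fun n : ℕ => (-1 : ℂ) ^ (n + 1) * w ^ (2 * n + 2) / (2 * (n : ℂ) - 1))
      (w ^ 2 + w ^ 3 * Complex.arctan w) := by
    refine (hasSum_nat_add_iff' 1).mp ?_
    simp only [sum_range_one, zero_add, pow_one, Nat.cast_zero, mul_zero, zero_sub]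
    have hv : w ^ 2 + w ^ 3 * Complex.arctan w - -1 * w ^ (2 * 0 + 2) / (-1) = w ^ 3 * Complex.arctan w := by ring
    rw [hv]
    refine (h.mul_left (w ^ 3)).congr_fun fun n => ?_
    rw [hcast]
    push_cast
    ring
  have hsum := ((hS1.sub hS2).sub hS3).add hS4
  have hval : w ^ 2 + w ^ 3 * Complex.arctan w - -w * Complex.arctan w - (w⁻¹ * Complex.arctan w - 1) +
      (-(w ^ 3)⁻¹ * Complex.arctan w + (w ^ 2)⁻¹ - 1 / 3) =
      Complex.arctan w * (w ^ 3 + w - w⁻¹ - (w ^ 3)⁻¹) + w ^ 2 + 1 + (w ^ 2)⁻¹ - 1 / 3 := by ring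
  rw [hval] at hsum
  refine hsum.congr_fun fun n => ?_
  push_cast
  rw [show ((-1 : ℂ)) ^ (n + 1) * (32 * ((n : ℂ) + 1)) / ((4 * ((n : ℂ) + 1) ^ 2 - 1) * (4 * ((n : ℂ) + 1) ^ 2 - 9)) =
      (-1 : ℂ) ^ (n + 1) * (32 * ((n : ℂ) + 1) / ((4 * ((n : ℂ) + 1) ^ 2 - 1) * (4 * ((n : ℂ) + 1) ^ 2 - 9))) by ring,
    coeff_partial_fractions n]
  ring

/-! ### §2 Radial extension to the unit circle (generic) -/

/-- Generic radial-limit principle: if `Σ|a_n| < ∞`, the even power series `Σ a_n w^{2n+2}` has sum `R(w)` at every point of the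
punctured open unit disc, and `R` is continuous at a point `w₀` of the unit circle, then `Σ a_n w₀^{2n+2} = R(w₀)` (M-test
continuity of the series on the closed disc + uniqueness of the limit along `r·w₀`, `r → 1⁻`). [folklore] -/
theorem hasSum_circle_of_hasSum_disc {a : ℕ → ℝ} (ha : Summable fun n => |a n|) {R : ℂ → ℂ} {w₀ : ℂ}
    (hw₀ : ‖w₀‖ = 1) (hR : ContinuousAt R w₀)
    (hdisc : ∀ w : ℂ, ‖w‖ < 1 → w ≠ 0 → HasSum (fun n : ℕ => ((a n : ℝ) : ℂ) * w ^ (2 * n + 2)) (R w)) :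
    HasSum (fun n : ℕ => ((a n : ℝ) : ℂ) * w₀ ^ (2 * n + 2)) (R w₀) := by
  have hbd : ∀ (n : ℕ) (w : ℂ), ‖w‖ ≤ 1 → ‖((a n : ℝ) : ℂ) * w ^ (2 * n + 2)‖ ≤ |a n| := by
    intro n w hw
    rw [norm_mul, Complex.norm_real, Real.norm_eq_abs, norm_pow]
    have h1 : ‖w‖ ^ (2 * n + 2) ≤ 1 := pow_le_one₀ (norm_nonneg _) hw
    calc |a n| * ‖w‖ ^ (2 * n + 2) ≤ |a n| * 1 := mul_le_mul_of_nonneg_left h1 (abs_nonneg _)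
      _ = |a n| := mul_one _
  set T : ℂ → ℂ := fun w => ∑' n : ℕ, ((a n : ℝ) : ℂ) * w ^ (2 * n + 2) with hT
  have hTcont : ContinuousOn T (closedBall (0 : ℂ) 1) := by
    refine continuousOn_tsum (fun n => ?_) ha (fun n w hw => hbd n w (mem_closedBall_zero_iff.mp hw))
    exact (continuous_const.mul (continuous_pow (2 * n + 2))).continuousOn
  have hsumm : Summable (fun n : ℕ => ((a n : ℝ) : ℂ) * w₀ ^ (2 * n + 2)) :=
    ha.of_norm_bounded (fun n => hbd n w₀ hw₀.le)
  have hw₀0 : w₀ ≠ 0 := by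
    intro h; rw [h, norm_zero] at hw₀; exact zero_ne_one hw₀
  set γ : ℝ → ℂ := fun r => (r : ℂ) * w₀ with hγ
  have hγ_cont : Continuous γ := Complex.continuous_ofReal.mul continuous_const
  have hγ1 : γ 1 = w₀ := by simp [hγ]
  have hγ_nhds : Tendsto γ (𝓝[<] (1:ℝ)) (𝓝 w₀) := by
    rw [← hγ1]; exact (hγ_cont.tendsto 1).mono_left nhdsWithin_le_nhds
  have hnormγ : ∀ r ∈ Ioo (0:ℝ) 1, ‖γ r‖ = r := fun r hr => by
    rw [hγ]
    simp only [norm_mul, Complex.norm_real, Real.norm_eq_abs, hw₀, mul_one]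
    exact abs_of_pos hr.1
  have hTlim : Tendsto (fun r => T (γ r)) (𝓝[<] (1:ℝ)) (𝓝 (T w₀)) := by
    have hcw : ContinuousWithinAt T (closedBall 0 1) w₀ := hTcont w₀ (mem_closedBall_zero_iff.mpr hw₀.le)
    have hγlim : Tendsto γ (𝓝[<] (1:ℝ)) (𝓝[closedBall 0 1] w₀) := by
      refine tendsto_nhdsWithin_iff.mpr ⟨hγ_nhds, ?_⟩
      filter_upwards [Ioo_mem_nhdsLT zero_lt_one] with r hr
      rw [mem_closedBall_zero_iff, hnormγ r hr]
      exact hr.2.le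
    exact hcw.tendsto.comp hγlim
  have hRlim : Tendsto (fun r => R (γ r)) (𝓝[<] (1:ℝ)) (𝓝 (R w₀)) := hR.tendsto.comp hγ_nhds
  have heq : (fun r => T (γ r)) =ᶠ[𝓝[<] (1:ℝ)] fun r => R (γ r) := by
    filter_upwards [Ioo_mem_nhdsLT zero_lt_one] with r hr
    have hnorm : ‖γ r‖ < 1 := by rw [hnormγ r hr]; exact hr.2
    have hne : γ r ≠ 0 := mul_ne_zero (by exact_mod_cast hr.1.ne') hw₀0
    exact (hdisc (γ r) hnorm hne).tsum_eq
  have hTR : T w₀ = R w₀ := tendsto_nhds_unique (hTlim.congr' heq) hRlim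
  rw [← hTR]
  exact hsumm.hasSum

/-! ### §3 The closed form at `w₀ = e^{iθ/2}` -/

/-- `e^{imx} − e^{−imx} = 2i·sin(mx)` in the form `w^m − (w^m)⁻¹`, `w = e^{ix}`. [folklore] -/
theorem exp_pow_sub_inv (x : ℝ) (m : ℕ) :
    Complex.exp ((x : ℂ) * I) ^ m - (Complex.exp ((x : ℂ) * I) ^ m)⁻¹ = 2 * ((Real.sin (m * x) : ℝ) : ℂ) * I := by
  have h1 : (m : ℂ) * ((x : ℂ) * I) = (((m : ℝ) * x : ℝ) : ℂ) * I := by push_cast; ring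
  have h2 : -((((m : ℝ) * x : ℝ) : ℂ) * I) = ((-((m : ℝ) * x) : ℝ) : ℂ) * I := by push_cast; ring
  rw [← Complex.exp_nat_mul, h1, ← Complex.exp_neg, h2, exp_ofReal_mul_I_eq, exp_ofReal_mul_I_eq, Real.cos_neg,
    Real.sin_neg]
  push_cast
  ring

/-- `e^{imx} + e^{−imx} = 2·cos(mx)` in the form `w^m + (w^m)⁻¹`, `w = e^{ix}`. [folklore] -/
theorem exp_pow_add_inv (x : ℝ) (m : ℕ) :
    Complex.exp ((x : ℂ) * I) ^ m + (Complex.exp ((x : ℂ) * I) ^ m)⁻¹ = 2 * ((Real.cos (m * x) : ℝ) : ℂ) := by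
  have h1 : (m : ℂ) * ((x : ℂ) * I) = (((m : ℝ) * x : ℝ) : ℂ) * I := by push_cast; ring
  have h2 : -((((m : ℝ) * x : ℝ) : ℂ) * I) = ((-((m : ℝ) * x) : ℝ) : ℂ) * I := by push_cast; ring
  rw [← Complex.exp_nat_mul, h1, ← Complex.exp_neg, h2, exp_ofReal_mul_I_eq, exp_ofReal_mul_I_eq, Real.cos_neg,
    Real.sin_neg]
  push_cast
  ring

/-- The closed form is continuous at every `w₀ = e^{iφ}`, `|φ| < π/2`. [folklore] -/
theorem continuousAt_closedForm {φ : ℝ} (hφ : φ ∈ Ioo (-(π / 2)) (π / 2)) :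
    ContinuousAt (fun w : ℂ => Complex.arctan w * (w ^ 3 + w - w⁻¹ - (w ^ 3)⁻¹) + w ^ 2 + 1 + (w ^ 2)⁻¹ - 1 / 3)
      (Complex.exp ((φ : ℂ) * I)) := by
  set w₀ := Complex.exp ((φ : ℂ) * I) with hw₀
  have hw₀0 : w₀ ≠ 0 := Complex.exp_ne_zero _
  have h1 := one_sub_exp_mul_I_mul_I_ne_zero hφ
  have h2 : (1 + w₀ * I) / (1 - w₀ * I) ∈ slitPlane := by
    rw [hw₀, one_add_exp_mul_I_div hφ]
    exact ofReal_mul_I_mem_slitPlane (div_pos (Real.cos_pos_of_mem_Ioo hφ) (one_add_sin_pos hφ)).ne'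
  have ha : ContinuousAt Complex.arctan w₀ := continuousAt_complex_arctan h1 h2
  have hp3 : ContinuousAt (fun w : ℂ => w ^ 3) w₀ := (continuous_pow 3).continuousAt
  have hp2 : ContinuousAt (fun w : ℂ => w ^ 2) w₀ := (continuous_pow 2).continuousAt
  have hi1 : ContinuousAt (fun w : ℂ => w⁻¹) w₀ := continuousAt_inv₀ hw₀0
  have hi3 : ContinuousAt (fun w : ℂ => (w ^ 3)⁻¹) w₀ := hp3.inv₀ (pow_ne_zero 3 hw₀0)
  have hi2 : ContinuousAt (fun w : ℂ => (w ^ 2)⁻¹) w₀ := hp2.inv₀ (pow_ne_zero 2 hw₀0)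
  exact ((((ha.mul (((hp3.add continuousAt_id).sub hi1).sub hi3)).add hp2).add continuousAt_const).add hi2).sub
    continuousAt_const

/-- **The closed form at `w₀ = e^{iθ/2}`**, `θ ∈ (−π, π)`:
`arctan(w₀)(w₀³ + w₀ − w₀⁻¹ − w₀⁻³) + w₀² + 1 + w₀⁻² − 1/3 = [2cos θ + 2/3 − gd⁻¹(θ/2)(sin(3θ/2) + sin(θ/2))] + i·(π/2)(sin(3θ/2) + sin(θ/2))`.
[folklore] -/
theorem closedForm_exp_half {θ : ℝ} (hθ : θ ∈ Ioo (-π) π) :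
    Complex.arctan (Complex.exp (((θ / 2 : ℝ) : ℂ) * I)) *
        (Complex.exp (((θ / 2 : ℝ) : ℂ) * I) ^ 3 + Complex.exp (((θ / 2 : ℝ) : ℂ) * I) -
          (Complex.exp (((θ / 2 : ℝ) : ℂ) * I))⁻¹ - (Complex.exp (((θ / 2 : ℝ) : ℂ) * I) ^ 3)⁻¹) +
        Complex.exp (((θ / 2 : ℝ) : ℂ) * I) ^ 2 + 1 + (Complex.exp (((θ / 2 : ℝ) : ℂ) * I) ^ 2)⁻¹ - 1 / 3 =
      ((2 * Real.cos θ + 2 / 3 -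
          Real.arsinh (Real.tan (θ / 2)) * (Real.sin (3 * (θ / 2)) + Real.sin (θ / 2)) : ℝ) : ℂ) +
        ((π / 2 * (Real.sin (3 * (θ / 2)) + Real.sin (θ / 2)) : ℝ) : ℂ) * I := by
  have hφ : θ / 2 ∈ Ioo (-(π / 2)) (π / 2) := by constructor <;> linarith [hθ.1, hθ.2]
  set w₀ := Complex.exp (((θ / 2 : ℝ) : ℂ) * I) with hw₀
  have h3 : w₀ ^ 3 - (w₀ ^ 3)⁻¹ = 2 * ((Real.sin (3 * (θ / 2)) : ℝ) : ℂ) * I := by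
    rw [hw₀, exp_pow_sub_inv]; push_cast; ring_nf
  have h1 : w₀ - w₀⁻¹ = 2 * ((Real.sin (θ / 2) : ℝ) : ℂ) * I := by
    have := exp_pow_sub_inv (θ / 2) 1
    rw [pow_one] at this
    rw [hw₀, this]; push_cast; ring_nf
  have h2 : w₀ ^ 2 + (w₀ ^ 2)⁻¹ = 2 * ((Real.cos θ : ℝ) : ℂ) := by
    rw [hw₀, exp_pow_add_inv]; push_cast; ring_nf
  have hP : w₀ ^ 3 + w₀ - w₀⁻¹ - (w₀ ^ 3)⁻¹ = (w₀ ^ 3 - (w₀ ^ 3)⁻¹) + (w₀ - w₀⁻¹) := by ring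
  rw [hP, h3, h1, show ∀ z : ℂ, z + w₀ ^ 2 + 1 + (w₀ ^ 2)⁻¹ - 1 / 3 = z + ((w₀ ^ 2 + (w₀ ^ 2)⁻¹) + 2 / 3) from
    fun z => by ring, h2, hw₀, arctan_exp_mul_I hφ]
  push_cast
  ring_nf
  rw [Complex.I_sq]
  ring

/-! ### §4 The two real series on `(−π, π)` -/

/-- At `w₀ = e^{iθ/2}` the (`2π`-scaled) complex series sums to the closed form of `closedForm_exp_half`. [folklore] -/
theorem hasSum_coeff_mul_exp_half {θ : ℝ} (hθ : θ ∈ Ioo (-π) π) :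
    HasSum (fun n : ℕ => ((((-1 : ℝ) ^ (n + 1) * (32 * ((n : ℝ) + 1)) /
        ((4 * ((n : ℝ) + 1) ^ 2 - 1) * (4 * ((n : ℝ) + 1) ^ 2 - 9))) : ℝ) : ℂ) *
        Complex.exp (((θ / 2 : ℝ) : ℂ) * I) ^ (2 * n + 2))
      (((2 * Real.cos θ + 2 / 3 -
          Real.arsinh (Real.tan (θ / 2)) * (Real.sin (3 * (θ / 2)) + Real.sin (θ / 2)) : ℝ) : ℂ) +
        ((π / 2 * (Real.sin (3 * (θ / 2)) + Real.sin (θ / 2)) : ℝ) : ℂ) * I) := by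
  have hφ : θ / 2 ∈ Ioo (-(π / 2)) (π / 2) := by constructor <;> linarith [hθ.1, hθ.2]
  rw [← closedForm_exp_half hθ]
  exact hasSum_circle_of_hasSum_disc summable_abs_coeff_T2 (by rw [Complex.norm_exp_ofReal_mul_I])
    (continuousAt_closedForm hφ) (fun w hw hw0 => hasSum_coeff_mul_pow_of_norm_lt_one hw hw0)

/-- **The sine series of the far-field shape** (PRICE-impl1 §4 T1, first series): for `θ ∈ (−π, π)`,
`sin(θ/2)·cos²(θ/2) = Σ_{n≥0} t_{n+1} sin((n+1)θ)`, `t_k = (−1)^k·16k/(π(4k²−1)(4k²−9))`. [folklore] -/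
theorem hasSum_sin_series_farFieldT2 {θ : ℝ} (hθ : θ ∈ Ioo (-π) π) :
    HasSum (fun n : ℕ => (-1 : ℝ) ^ (n + 1) * (16 * ((n : ℝ) + 1)) /
        (π * ((4 * ((n : ℝ) + 1) ^ 2 - 1) * (4 * ((n : ℝ) + 1) ^ 2 - 9))) * Real.sin ((n + 1) * θ))
      (Real.sin (θ / 2) * Real.cos (θ / 2) ^ 2) := by
  have h := (Complex.hasSum_im (hasSum_coeff_mul_exp_half hθ)).div_const (2 * π)
  simp only [Complex.add_im, Complex.ofReal_im, Complex.mul_im, Complex.ofReal_re, Complex.I_re, Complex.I_im,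
    mul_zero, mul_one, zero_add, add_zero] at h
  rw [sin_half_mul_cos_half_sq, show (Real.sin (3 * (θ / 2)) + Real.sin (θ / 2)) / 4 =
    π / 2 * (Real.sin (3 * (θ / 2)) + Real.sin (θ / 2)) / (2 * π) by field_simp; ring]
  refine h.congr_fun fun n => ?_
  rw [← Complex.exp_nat_mul]
  have : ((2 * n + 2 : ℕ) : ℂ) * (((θ / 2 : ℝ) : ℂ) * I) = (((n + 1) * θ : ℝ) : ℂ) * I := by push_cast; ring
  rw [this, Complex.exp_ofReal_mul_I_im, Complex.exp_ofReal_mul_I_re]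
  field_simp
  ring

/-- **The cosine companion**: for `θ ∈ (−π, π)`,
`Σ_{n≥0} t_{n+1} cos((n+1)θ) = (2π)⁻¹·[2cos θ + 2/3 − arsinh(tan(θ/2))·(sin(3θ/2) + sin(θ/2))]`. [folklore] -/
theorem hasSum_cos_series_farFieldT2 {θ : ℝ} (hθ : θ ∈ Ioo (-π) π) :
    HasSum (fun n : ℕ => (-1 : ℝ) ^ (n + 1) * (16 * ((n : ℝ) + 1)) /
        (π * ((4 * ((n : ℝ) + 1) ^ 2 - 1) * (4 * ((n : ℝ) + 1) ^ 2 - 9))) * Real.cos ((n + 1) * θ))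
      ((2 * Real.cos θ + 2 / 3 -
          Real.arsinh (Real.tan (θ / 2)) * (Real.sin (3 * (θ / 2)) + Real.sin (θ / 2))) / (2 * π)) := by
  have h := (Complex.hasSum_re (hasSum_coeff_mul_exp_half hθ)).div_const (2 * π)
  simp only [Complex.add_re, Complex.ofReal_re, Complex.mul_re, Complex.ofReal_im, Complex.I_re, Complex.I_im,
    mul_zero, mul_one, sub_zero, add_zero, zero_mul, sub_self] at h
  refine h.congr_fun fun n => ?_
  rw [← Complex.exp_nat_mul]
  have : ((2 * n + 2 : ℕ) : ℂ) * (((θ / 2 : ℝ) : ℂ) * I) = (((n + 1) * θ : ℝ) : ℂ) * I := by push_cast; ring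
  rw [this, Complex.exp_ofReal_mul_I_re]
  field_simp
  ring

/-! ### §5 Truncation error: exact telescoping tail `Σ_{k>K+1}|t_k| = 2/(π(2K+1)(2K+5))` -/

/-- The absolute value of the far coefficients telescopes: for `m = n + K + 2 ≥ 2`,
`16m/((4m²−1)(4m²−9)) = ½·[2/((2m−3)(2m−1)) − 2/((2m+1)(2m+3))]`, written with `2m−3 = 2(n+K)+1`. [folklore] -/
theorem abs_coeff_shift_eq (n K : ℕ) :
    |(-1 : ℝ) ^ (n + (K + 1) + 1) * (16 * (((n + (K + 1) : ℕ) : ℝ) + 1)) /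
        (π * ((4 * (((n + (K + 1) : ℕ) : ℝ) + 1) ^ 2 - 1) * (4 * (((n + (K + 1) : ℕ) : ℝ) + 1) ^ 2 - 9)))| =
      (2 / ((2 * (n + K : ℝ) + 1) * (2 * (n + K : ℝ) + 3)) -
        2 / ((2 * (n + (K + 2) : ℝ) + 1) * (2 * (n + (K + 2) : ℝ) + 3))) / (2 * π) := by
  have hn : (0:ℝ) ≤ n := n.cast_nonneg
  have hK : (0:ℝ) ≤ K := K.cast_nonneg
  push_cast
  have hA : (0:ℝ) < 4 * ((n:ℝ) + (K + 1) + 1) ^ 2 - 1 := by nlinarith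
  have hB : (0:ℝ) < 4 * ((n:ℝ) + (K + 1) + 1) ^ 2 - 9 := by nlinarith
  rw [abs_div, abs_mul, abs_pow, abs_neg, abs_one, one_pow, one_mul,
    abs_of_pos (by positivity : (0:ℝ) < 16 * ((n:ℝ) + (K + 1) + 1)), abs_of_pos (mul_pos Real.pi_pos (mul_pos hA hB))]
  have h1 : (2 * ((n:ℝ) + K) + 1) ≠ 0 := by positivity
  have h2 : (2 * ((n:ℝ) + K) + 3) ≠ 0 := by positivity
  have h3 : (2 * ((n:ℝ) + (K + 2)) + 1) ≠ 0 := by positivity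
  have h4 : (2 * ((n:ℝ) + (K + 2)) + 3) ≠ 0 := by positivity
  rw [div_sub_div _ _ (mul_ne_zero h1 h2) (mul_ne_zero h3 h4),
    div_div, div_eq_div_iff (mul_pos Real.pi_pos (mul_pos hA hB)).ne'
      (mul_ne_zero (mul_ne_zero (mul_ne_zero h1 h2) (mul_ne_zero h3 h4)) (by positivity))]
  ring

/-- **Truncation error of the sine series of the far-field shape**: for `θ ∈ (−π, π)` and every `K`, after `K + 1` terms
`|sin(θ/2)cos²(θ/2) − Σ_{n≤K} t_{n+1} sin((n+1)θ)| ≤ 2/(π(2K+1)(2K+5))` (`= Σ_{k>K+1}|t_k|`, exact telescoping). [folklore] -/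
theorem abs_farFieldT2_sub_sum_le {θ : ℝ} (hθ : θ ∈ Ioo (-π) π) (K : ℕ) :
    |Real.sin (θ / 2) * Real.cos (θ / 2) ^ 2 -
        ∑ n ∈ range (K + 1), (-1 : ℝ) ^ (n + 1) * (16 * ((n : ℝ) + 1)) /
          (π * ((4 * ((n : ℝ) + 1) ^ 2 - 1) * (4 * ((n : ℝ) + 1) ^ 2 - 9))) * Real.sin ((n + 1) * θ)| ≤
      2 / (π * (2 * K + 1) * (2 * K + 5)) := by
  have hG := hasSum_sin_series_farFieldT2 hθ
  have htail := (hasSum_nat_add_iff' (K + 1)).mpr hG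
  have hbound := ((hasSum_two_div_odd_mul_odd_tail K).sub (hasSum_two_div_odd_mul_odd_tail (K + 2))).div_const
    (2 * π)
  have hval : (1 / (2 * (K : ℝ) + 1) - 1 / (2 * ((K + 2 : ℕ) : ℝ) + 1)) / (2 * π) = 2 / (π * (2 * K + 1) * (2 * K + 5)) := by
    push_cast
    field_simp
    ring
  rw [hval] at hbound
  rw [← Real.norm_eq_abs]
  refine htail.norm_le_of_bounded hbound fun n => ?_
  rw [Real.norm_eq_abs, abs_mul, abs_coeff_shift_eq n K]
  have hs : |Real.sin ((((n + (K + 1) : ℕ) : ℝ) + 1) * θ)| ≤ 1 := Real.abs_sin_le_one _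
  have hnn : 0 ≤ (2 / ((2 * (n + K : ℝ) + 1) * (2 * (n + K : ℝ) + 3)) -
      2 / ((2 * (n + (K + 2) : ℝ) + 1) * (2 * (n + (K + 2) : ℝ) + 3))) / (2 * π) := by
    rw [← abs_coeff_shift_eq n K]; exact abs_nonneg _
  calc _ ≤ (2 / ((2 * (n + K : ℝ) + 1) * (2 * (n + K : ℝ) + 3)) -
        2 / ((2 * (n + (K + 2) : ℝ) + 1) * (2 * (n + (K + 2) : ℝ) + 3))) / (2 * π) * 1 :=
        mul_le_mul_of_nonneg_left hs hnn
    _ = _ := by push_cast; ring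

end SheetRFarFieldT2SineSeries
end Summit.NavierStokesRegularity.OSWSelfSimilar
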